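import Summits.FinalStateConjecture.FinalStateConjecture.Theorems.WeightedQuasiStationarity.Negative.KinematicShadowCalculus

/-!
# Route EIHFluxBalance — item `WeightedQuasiStationarity` (stmt-FinalStateConjecture-16928),
# negative lane: calculus of the SECOND witness `ε (1+t²)^{-1/8} sin((1+t²)^{1/4})` (jet-rate version)

Helper file of the strengthened kinematic-shadow refutation
`…WeightedQuasiStationarity.Negative.KinematicShadowJetRates` (`--supports stmt-FinalStateConjecture-16928`;
no Theses decl is asserted). The first witness (`(1+t²)^{-1/4} sin t`, file `…KinematicShadow`) has
`ẅ ≍ t^{-1/2}`, so it violates the WEIGHTED second-order rate `t^{3/4}‖(Λe₀)¨‖ → 0`; the witness of this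
file has speed `u = ε A S` with amplitude `A = (1+t²)^{-1/8}` and phase-modulated oscillation
`S = sin ∘ ψ`, `ψ = (1+t²)^{1/4} ≍ √t`, so that `u̇ ≍ t^{-3/4} cos ψ` (the weighted FIRST-order rate
fails) while `ü = O(t^{-5/4})`, `u⃛ = O(t^{-7/4})` (the weighted rates of orders `2, 3` hold).

* §1 abstract chains: `sin ∘ ψ` to third order, the Leibniz chain of a product `A S` to third order,
  and the closed forms of `iteratedDeriv m ((ε A S) • e)`, `m ≤ 3`;
* §2 growth bookkeeping in Mathlib's `IsBigO` language along `atTop` against the powers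
  `(1 + t²)^e`: products, sums, monotonicity in the exponent, `|t|ᵏ = O((1+t²)^{k/2})`, and the sharp
  orders of the amplitude family `(1+t²)ᵖ` and its three derivatives (`p`, `p − 1/2`, `p − 1`,
  `p − 3/2`);
* §3 the concrete orders: `ψ⁽ⁱ⁾ = O((1+t²)^{1/4 - i/2})`, `S⁽ⁱ⁾ = O((1+t²)^{-i/4})` (`i ≤ 3`), and
  `u⁽ᵏ⁾ = O((1+t²)^{-1/8 - k/4})` (`k ≤ 3`) for `u = ε A S`.
-/

set_option linter.dupNamespace false

noncomputable section

namespace Summit.FinalStateConjecture.FinalStateConjecture.Theorems.WeightedQuasiStationarity.Negative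

open scoped Topology
open Filter Set Function Metric Asymptotics Literature.Geometry.Lorentzian

/-! ### §1 Abstract chains -/

/-- First derivative of `sin ∘ ψ`. [folklore] -/
theorem hasDerivAt_sinComp0 {ψ ψ1 : ℝ → ℝ} (hψ : ∀ t, HasDerivAt ψ (ψ1 t) t) (t : ℝ) :
    HasDerivAt (fun s ↦ Real.sin (ψ s)) (Real.cos (ψ t) * ψ1 t) t :=
  (Real.hasDerivAt_sin (ψ t)).comp t (hψ t)

/-- Second derivative of `sin ∘ ψ`. [folklore] -/
theorem hasDerivAt_sinComp1 {ψ ψ1 ψ2 : ℝ → ℝ} (hψ : ∀ t, HasDerivAt ψ (ψ1 t) t)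
    (hψ1 : ∀ t, HasDerivAt ψ1 (ψ2 t) t) (t : ℝ) :
    HasDerivAt (fun s ↦ Real.cos (ψ s) * ψ1 s)
      (-(Real.sin (ψ t) * ψ1 t ^ 2) + Real.cos (ψ t) * ψ2 t) t := by
  have hc : HasDerivAt (fun s ↦ Real.cos (ψ s)) (-Real.sin (ψ t) * ψ1 t) t :=
    (Real.hasDerivAt_cos (ψ t)).comp t (hψ t)
  exact (hc.mul (hψ1 t)).congr_deriv (by ring)

/-- Third derivative of `sin ∘ ψ`. [folklore] -/
theorem hasDerivAt_sinComp2 {ψ ψ1 ψ2 ψ3 : ℝ → ℝ} (hψ : ∀ t, HasDerivAt ψ (ψ1 t) t)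
    (hψ1 : ∀ t, HasDerivAt ψ1 (ψ2 t) t) (hψ2 : ∀ t, HasDerivAt ψ2 (ψ3 t) t) (t : ℝ) :
    HasDerivAt (fun s ↦ -(Real.sin (ψ s) * ψ1 s ^ 2) + Real.cos (ψ s) * ψ2 s)
      (-(Real.cos (ψ t) * ψ1 t ^ 3) - 3 * Real.sin (ψ t) * ψ1 t * ψ2 t +
        Real.cos (ψ t) * ψ3 t) t := by
  have hs : HasDerivAt (fun s ↦ Real.sin (ψ s)) (Real.cos (ψ t) * ψ1 t) t :=
    (Real.hasDerivAt_sin (ψ t)).comp t (hψ t)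
  have hc : HasDerivAt (fun s ↦ Real.cos (ψ s)) (-Real.sin (ψ t) * ψ1 t) t :=
    (Real.hasDerivAt_cos (ψ t)).comp t (hψ t)
  have h := ((hs.mul ((hψ1 t).pow 2)).neg).add (hc.mul (hψ2 t))
  refine h.congr_deriv ?_
  simp only [Nat.cast_ofNat, Pi.pow_apply]
  ring

/-- First derivative of a product `A S`. [folklore] -/
theorem hasDerivAt_prod0 {A A1 S S1 : ℝ → ℝ} (hA : ∀ t, HasDerivAt A (A1 t) t)
    (hS : ∀ t, HasDerivAt S (S1 t) t) (t : ℝ) :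
    HasDerivAt (fun s ↦ A s * S s) (A1 t * S t + A t * S1 t) t :=
  (hA t).mul (hS t)

/-- Second derivative of a product `A S`. [folklore] -/
theorem hasDerivAt_prod1 {A A1 A2 S S1 S2 : ℝ → ℝ} (hA : ∀ t, HasDerivAt A (A1 t) t)
    (hA1 : ∀ t, HasDerivAt A1 (A2 t) t) (hS : ∀ t, HasDerivAt S (S1 t) t)
    (hS1 : ∀ t, HasDerivAt S1 (S2 t) t) (t : ℝ) :
    HasDerivAt (fun s ↦ A1 s * S s + A s * S1 s)
      (A2 t * S t + 2 * A1 t * S1 t + A t * S2 t) t := by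
  have h := ((hA1 t).mul (hS t)).add ((hA t).mul (hS1 t))
  exact h.congr_deriv (by ring)

/-- Third derivative of a product `A S`. [folklore] -/
theorem hasDerivAt_prod2 {A A1 A2 A3 S S1 S2 S3 : ℝ → ℝ} (hA : ∀ t, HasDerivAt A (A1 t) t)
    (hA1 : ∀ t, HasDerivAt A1 (A2 t) t) (hA2 : ∀ t, HasDerivAt A2 (A3 t) t)
    (hS : ∀ t, HasDerivAt S (S1 t) t) (hS1 : ∀ t, HasDerivAt S1 (S2 t) t)
    (hS2 : ∀ t, HasDerivAt S2 (S3 t) t) (t : ℝ) :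
    HasDerivAt (fun s ↦ A2 s * S s + 2 * A1 s * S1 s + A s * S2 s)
      (A3 t * S t + 3 * A2 t * S1 t + 3 * A1 t * S2 t + A t * S3 t) t := by
  have h := (((hA2 t).mul (hS t)).add (((hA1 t).const_mul 2).mul (hS1 t))).add
    ((hA t).mul (hS2 t))
  exact h.congr_deriv (by ring)

/-- The three iterated derivatives of `w = (ε A S) • e` in closed form (abstract chains).
[folklore] -/
theorem iteratedDeriv_w_prod {A A1 A2 A3 S S1 S2 S3 : ℝ → ℝ} (hA : ∀ t, HasDerivAt A (A1 t) t)
    (hA1 : ∀ t, HasDerivAt A1 (A2 t) t) (hA2 : ∀ t, HasDerivAt A2 (A3 t) t)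
    (hS : ∀ t, HasDerivAt S (S1 t) t) (hS1 : ∀ t, HasDerivAt S1 (S2 t) t)
    (hS2 : ∀ t, HasDerivAt S2 (S3 t) t) (ε : ℝ) (e : E3) :
    iteratedDeriv 1 (fun s ↦ (ε * (A s * S s)) • e) =
        (fun t ↦ (ε * (A1 t * S t + A t * S1 t)) • e) ∧
      iteratedDeriv 2 (fun s ↦ (ε * (A s * S s)) • e) =
        (fun t ↦ (ε * (A2 t * S t + 2 * A1 t * S1 t + A t * S2 t)) • e) ∧
      iteratedDeriv 3 (fun s ↦ (ε * (A s * S s)) • e) =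
        (fun t ↦ (ε * (A3 t * S t + 3 * A2 t * S1 t + 3 * A1 t * S2 t + A t * S3 t)) • e) := by
  have h0 : ∀ t, HasDerivAt (fun s ↦ ε * (A s * S s)) (ε * (A1 t * S t + A t * S1 t)) t :=
    fun t ↦ (hasDerivAt_prod0 hA hS t).const_mul ε
  have h1 : ∀ t, HasDerivAt (fun s ↦ ε * (A1 s * S s + A s * S1 s))
      (ε * (A2 t * S t + 2 * A1 t * S1 t + A t * S2 t)) t :=
    fun t ↦ (hasDerivAt_prod1 hA hA1 hS hS1 t).const_mul ε
  have h2 : ∀ t, HasDerivAt (fun s ↦ ε * (A2 s * S s + 2 * A1 s * S1 s + A s * S2 s))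
      (ε * (A3 t * S t + 3 * A2 t * S1 t + 3 * A1 t * S2 t + A t * S3 t)) t :=
    fun t ↦ (hasDerivAt_prod2 hA hA1 hA2 hS hS1 hS2 t).const_mul ε
  have e1 : iteratedDeriv 1 (fun s ↦ (ε * (A s * S s)) • e) =
      (fun t ↦ (ε * (A1 t * S t + A t * S1 t)) • e) := by
    rw [iteratedDeriv_one, deriv_smul_vec h0 e]
  have e2 : iteratedDeriv 2 (fun s ↦ (ε * (A s * S s)) • e) =
      (fun t ↦ (ε * (A2 t * S t + 2 * A1 t * S1 t + A t * S2 t)) • e) := by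
    rw [iteratedDeriv_succ, e1, deriv_smul_vec h1 e]
  have e3 : iteratedDeriv 3 (fun s ↦ (ε * (A s * S s)) • e) =
      (fun t ↦ (ε * (A3 t * S t + 3 * A2 t * S1 t + 3 * A1 t * S2 t + A t * S3 t)) • e) := by
    rw [iteratedDeriv_succ, e2, deriv_smul_vec h2 e]
  exact ⟨e1, e2, e3⟩

/-! ### §2 Growth bookkeeping against the powers `(1 + t²)^e` -/

/-- Monotonicity in the exponent as an `IsBigO` relation. [folklore] -/
theorem isBigO_rpow_of_le {a b : ℝ} (h : a ≤ b) :
    (fun t : ℝ ↦ (1 + t ^ 2) ^ a) =O[atTop] (fun t : ℝ ↦ (1 + t ^ 2) ^ b) := by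
  refine IsBigO.of_bound 1 (Eventually.of_forall fun t ↦ ?_)
  rw [Real.norm_eq_abs, Real.norm_eq_abs, one_mul, abs_of_nonneg (Real.rpow_nonneg (by positivity) _),
    abs_of_nonneg (Real.rpow_nonneg (by positivity) _)]
  exact rpow_one_add_sq_mono t h

/-- Products of powers. [folklore] -/
theorem rpow_one_add_sq_mul (t a b : ℝ) : (1 + t ^ 2) ^ a * (1 + t ^ 2) ^ b = (1 + t ^ 2) ^ (a + b) :=
  (Real.rpow_add (by positivity) a b).symm

/-- Product rule for the orders. [folklore] -/
theorem isBigO_mul_rpow {X Y : ℝ → ℝ} {a b : ℝ}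
    (hX : X =O[atTop] (fun t : ℝ ↦ (1 + t ^ 2) ^ a)) (hY : Y =O[atTop] (fun t : ℝ ↦ (1 + t ^ 2) ^ b)) :
    (fun t ↦ X t * Y t) =O[atTop] (fun t : ℝ ↦ (1 + t ^ 2) ^ (a + b)) := by
  have h := hX.mul hY
  refine h.trans (IsBigO.of_bound 1 (Eventually.of_forall fun t ↦ ?_))
  rw [rpow_one_add_sq_mul, one_mul]

/-- Sum rule for the orders (both exponents below the target). [folklore] -/
theorem isBigO_add_rpow {X Y : ℝ → ℝ} {a b e : ℝ} (ha : a ≤ e) (hb : b ≤ e)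
    (hX : X =O[atTop] (fun t : ℝ ↦ (1 + t ^ 2) ^ a)) (hY : Y =O[atTop] (fun t : ℝ ↦ (1 + t ^ 2) ^ b)) :
    (fun t ↦ X t + Y t) =O[atTop] (fun t : ℝ ↦ (1 + t ^ 2) ^ e) :=
  (hX.trans (isBigO_rpow_of_le ha)).add (hY.trans (isBigO_rpow_of_le hb))

/-- A factor bounded by `1` in absolute value does not change the order. [folklore] -/
theorem isBigO_bdd_mul_rpow {B X : ℝ → ℝ} {a : ℝ} (hB : ∀ t, |B t| ≤ 1)
    (hX : X =O[atTop] (fun t : ℝ ↦ (1 + t ^ 2) ^ a)) :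
    (fun t ↦ B t * X t) =O[atTop] (fun t : ℝ ↦ (1 + t ^ 2) ^ a) := by
  have hB' : B =O[atTop] (fun t : ℝ ↦ (1 + t ^ 2) ^ (0 : ℝ)) := by
    refine IsBigO.of_bound 1 (Eventually.of_forall fun t ↦ ?_)
    rw [Real.rpow_zero, Real.norm_eq_abs, norm_one, one_mul]
    exact hB t
  have h := isBigO_mul_rpow hB' hX
  rwa [zero_add] at h

/-- `|t|ᵏ = O((1+t²)^{k/2})` (indeed `|t| ≤ (1+t²)^{1/2}`). [folklore] -/
theorem isBigO_pow_rpow (k : ℕ) :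
    (fun t : ℝ ↦ t ^ k) =O[atTop] (fun t : ℝ ↦ (1 + t ^ 2) ^ ((k : ℝ) / 2)) := by
  refine IsBigO.of_bound 1 (Eventually.of_forall fun t ↦ ?_)
  have hf : (0 : ℝ) ≤ 1 + t ^ 2 := by positivity
  have h1 : |t| ≤ (1 + t ^ 2) ^ (1 / 2 : ℝ) := by
    rw [← Real.sqrt_eq_rpow]
    exact Real.abs_le_sqrt (by nlinarith)
  rw [Real.norm_eq_abs, Real.norm_eq_abs, one_mul, abs_pow,
    abs_of_nonneg (Real.rpow_nonneg hf _)]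
  calc |t| ^ k ≤ ((1 + t ^ 2) ^ (1 / 2 : ℝ)) ^ k := pow_le_pow_left₀ (abs_nonneg t) h1 k
    _ = (1 + t ^ 2) ^ ((k : ℝ) / 2) := by
        rw [← Real.rpow_natCast, ← Real.rpow_mul hf]
        ring_nf

/-- **Sharp orders of the amplitude family.** For `A = (1+t²)ᵖ` and its three derivatives
(`hasDerivAt_ampl0/1/2`): `A = O((1+t²)ᵖ)`, `A' = O((1+t²)^{p-1/2})`, `A'' = O((1+t²)^{p-1})`,
`A''' = O((1+t²)^{p-3/2})`. [folklore] -/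
theorem isBigO_ampl (p : ℝ) :
    (fun t : ℝ ↦ (1 + t ^ 2) ^ p) =O[atTop] (fun t : ℝ ↦ (1 + t ^ 2) ^ p) ∧
    (fun t : ℝ ↦ 2 * t * p * (1 + t ^ 2) ^ (p - 1)) =O[atTop] (fun t : ℝ ↦ (1 + t ^ 2) ^ (p - 1 / 2)) ∧
    (fun t : ℝ ↦ 2 * p * (1 + t ^ 2) ^ (p - 1) + 4 * p * (p - 1) * t ^ 2 * (1 + t ^ 2) ^ (p - 2))
      =O[atTop] (fun t : ℝ ↦ (1 + t ^ 2) ^ (p - 1)) ∧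
    (fun t : ℝ ↦ 12 * p * (p - 1) * t * (1 + t ^ 2) ^ (p - 2) +
        8 * p * (p - 1) * (p - 2) * t ^ 3 * (1 + t ^ 2) ^ (p - 3))
      =O[atTop] (fun t : ℝ ↦ (1 + t ^ 2) ^ (p - 3 / 2)) := by
  have ht1 : (fun t : ℝ ↦ t) =O[atTop] (fun t : ℝ ↦ (1 + t ^ 2) ^ ((1 : ℝ) / 2)) := by
    simpa using isBigO_pow_rpow 1
  have ht2 : (fun t : ℝ ↦ t ^ 2) =O[atTop] (fun t : ℝ ↦ (1 + t ^ 2) ^ (1 : ℝ)) :=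
    (isBigO_pow_rpow 2).congr_right fun t ↦ by norm_num
  have ht3 : (fun t : ℝ ↦ t ^ 3) =O[atTop] (fun t : ℝ ↦ (1 + t ^ 2) ^ ((3 : ℝ) / 2)) := by
    simpa using isBigO_pow_rpow 3
  have hr : ∀ q : ℝ, (fun t : ℝ ↦ (1 + t ^ 2) ^ q) =O[atTop] (fun t : ℝ ↦ (1 + t ^ 2) ^ q) :=
    fun q ↦ isBigO_refl _ _
  refine ⟨hr p, ?_, ?_, ?_⟩
  · -- `2pt(1+t²)^{p-1}`
    have h := (isBigO_mul_rpow ht1 (hr (p - 1))).const_mul_left (2 * p)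
    refine (h.congr_left fun t ↦ ?_).trans (isBigO_rpow_of_le (by linarith))
    ring
  · -- `2p(1+t²)^{p-1} + 4p(p-1)t²(1+t²)^{p-2}`
    have h1 := (hr (p - 1)).const_mul_left (2 * p)
    have h2 := (isBigO_mul_rpow ht2 (hr (p - 2))).const_mul_left (4 * p * (p - 1))
    have h := isBigO_add_rpow (e := p - 1) le_rfl (by linarith) h1 h2
    refine h.congr_left fun t ↦ ?_
    ring
  · -- `12p(p-1)t(1+t²)^{p-2} + 8p(p-1)(p-2)t³(1+t²)^{p-3}`
    have h1 := (isBigO_mul_rpow ht1 (hr (p - 2))).const_mul_left (12 * p * (p - 1))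
    have h2 := (isBigO_mul_rpow ht3 (hr (p - 3))).const_mul_left (8 * p * (p - 1) * (p - 2))
    have h := isBigO_add_rpow (e := p - 3 / 2) (by linarith) (by linarith) h1 h2
    refine h.congr_left fun t ↦ ?_
    ring

/-- An order with a negative exponent forces convergence to `0`. [folklore] -/
theorem tendsto_zero_of_isBigO_rpow {X : ℝ → ℝ} {e : ℝ} (he : e < 0)
    (hX : X =O[atTop] (fun t : ℝ ↦ (1 + t ^ 2) ^ e)) : Tendsto X atTop (𝓝 0) :=
  hX.trans_tendsto (tendsto_rpow_one_add_sq he)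

/-! ### §3 Orders of the second witness `u = ε A S`, `S = sin ∘ ψ` -/

/-- **Orders of the speed of the second witness and of its three derivatives.** Abstract form: if
the amplitude chain has orders `A = O(f^{-1/8})`, `A' = O(f^{-5/8})`, `A'' = O(f^{-9/8})`,
`A''' = O(f^{-13/8})` and the phase chain `ψ' = O(f^{-1/4})`, `ψ'' = O(f^{-3/4})`, `ψ''' = O(f^{-5/4})`
(`f = 1 + t²`; the orders of `(1+t²)^{-1/8}` and `(1+t²)^{1/4}`, `isBigO_ampl`), then for
`S = sin ∘ ψ` the Leibniz expressions of `u = ε A S`, `u̇`, `ü`, `u⃛` (`iteratedDeriv_w_prod`) have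
orders `f^{-1/8}`, `f^{-3/8}`, `f^{-5/8}`, `f^{-7/8}`: the first-order rate is NOT `o(t^{-3/4})`-small
by order counting, but the second and third are `O(t^{-5/4})`, `O(t^{-7/4})`. [folklore] -/
theorem isBigO_witness2 {A0 A1 A2 A3 ψ0 ψ1 ψ2 ψ3 : ℝ → ℝ} (ε : ℝ)
    (hA0 : A0 =O[atTop] (fun t : ℝ ↦ (1 + t ^ 2) ^ (-(1 / 8) : ℝ)))
    (hA1 : A1 =O[atTop] (fun t : ℝ ↦ (1 + t ^ 2) ^ (-(5 / 8) : ℝ)))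
    (hA2 : A2 =O[atTop] (fun t : ℝ ↦ (1 + t ^ 2) ^ (-(9 / 8) : ℝ)))
    (hA3 : A3 =O[atTop] (fun t : ℝ ↦ (1 + t ^ 2) ^ (-(13 / 8) : ℝ)))
    (hψ1 : ψ1 =O[atTop] (fun t : ℝ ↦ (1 + t ^ 2) ^ (-(1 / 4) : ℝ)))
    (hψ2 : ψ2 =O[atTop] (fun t : ℝ ↦ (1 + t ^ 2) ^ (-(3 / 4) : ℝ)))
    (hψ3 : ψ3 =O[atTop] (fun t : ℝ ↦ (1 + t ^ 2) ^ (-(5 / 4) : ℝ))) :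
    (fun t ↦ ε * (A0 t * Real.sin (ψ0 t))) =O[atTop] (fun t : ℝ ↦ (1 + t ^ 2) ^ (-(1 / 8) : ℝ)) ∧
    (fun t ↦ ε * (A1 t * Real.sin (ψ0 t) + A0 t * (Real.cos (ψ0 t) * ψ1 t)))
      =O[atTop] (fun t : ℝ ↦ (1 + t ^ 2) ^ (-(3 / 8) : ℝ)) ∧
    (fun t ↦ ε * (A2 t * Real.sin (ψ0 t) + 2 * A1 t * (Real.cos (ψ0 t) * ψ1 t) +
        A0 t * (-(Real.sin (ψ0 t) * ψ1 t ^ 2) + Real.cos (ψ0 t) * ψ2 t)))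
      =O[atTop] (fun t : ℝ ↦ (1 + t ^ 2) ^ (-(5 / 8) : ℝ)) ∧
    (fun t ↦ ε * (A3 t * Real.sin (ψ0 t) + 3 * A2 t * (Real.cos (ψ0 t) * ψ1 t) +
        3 * A1 t * (-(Real.sin (ψ0 t) * ψ1 t ^ 2) + Real.cos (ψ0 t) * ψ2 t) +
        A0 t * (-(Real.cos (ψ0 t) * ψ1 t ^ 3) - 3 * Real.sin (ψ0 t) * ψ1 t * ψ2 t +
          Real.cos (ψ0 t) * ψ3 t)))
      =O[atTop] (fun t : ℝ ↦ (1 + t ^ 2) ^ (-(7 / 8) : ℝ)) := by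
  have hs : ∀ t, |Real.sin (ψ0 t)| ≤ 1 := fun t ↦ Real.abs_sin_le_one _
  have hc : ∀ t, |Real.cos (ψ0 t)| ≤ 1 := fun t ↦ Real.abs_cos_le_one _
  have hns : ∀ t, |(-Real.sin (ψ0 t))| ≤ 1 := fun t ↦ by rw [abs_neg]; exact hs t
  have hnc : ∀ t, |(-Real.cos (ψ0 t))| ≤ 1 := fun t ↦ by rw [abs_neg]; exact hc t
  -- orders of the trigonometric factors `S, S', S'', S'''`
  have S0 : (fun t ↦ Real.sin (ψ0 t)) =O[atTop] (fun t : ℝ ↦ (1 + t ^ 2) ^ (0 : ℝ)) := by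
    refine IsBigO.of_bound 1 (Eventually.of_forall fun t ↦ ?_)
    rw [Real.rpow_zero, Real.norm_eq_abs, norm_one, one_mul]
    exact hs t
  have S1 : (fun t ↦ Real.cos (ψ0 t) * ψ1 t) =O[atTop] (fun t : ℝ ↦ (1 + t ^ 2) ^ (-(1 / 4) : ℝ)) :=
    isBigO_bdd_mul_rpow hc hψ1
  have S2 : (fun t ↦ -(Real.sin (ψ0 t) * ψ1 t ^ 2) + Real.cos (ψ0 t) * ψ2 t)
      =O[atTop] (fun t : ℝ ↦ (1 + t ^ 2) ^ (-(1 / 2) : ℝ)) := by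
    have h1 : (fun t ↦ (-Real.sin (ψ0 t)) * (ψ1 t * ψ1 t))
        =O[atTop] (fun t : ℝ ↦ (1 + t ^ 2) ^ (-(1 / 4) + -(1 / 4) : ℝ)) :=
      isBigO_bdd_mul_rpow hns (isBigO_mul_rpow hψ1 hψ1)
    have h2 := isBigO_bdd_mul_rpow hc hψ2
    have h := isBigO_add_rpow (e := -(1 / 2)) (by norm_num) (by norm_num) h1 h2
    exact h.congr_left fun t ↦ by ring
  have S3 : (fun t ↦ -(Real.cos (ψ0 t) * ψ1 t ^ 3) - 3 * Real.sin (ψ0 t) * ψ1 t * ψ2 t +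
      Real.cos (ψ0 t) * ψ3 t) =O[atTop] (fun t : ℝ ↦ (1 + t ^ 2) ^ (-(3 / 4) : ℝ)) := by
    have h1 : (fun t ↦ (-Real.cos (ψ0 t)) * (ψ1 t * (ψ1 t * ψ1 t)))
        =O[atTop] (fun t : ℝ ↦ (1 + t ^ 2) ^ (-(1 / 4) + (-(1 / 4) + -(1 / 4)) : ℝ)) :=
      isBigO_bdd_mul_rpow hnc (isBigO_mul_rpow hψ1 (isBigO_mul_rpow hψ1 hψ1))
    have h2 : (fun t ↦ (-Real.sin (ψ0 t)) * (ψ1 t * ψ2 t))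
        =O[atTop] (fun t : ℝ ↦ (1 + t ^ 2) ^ (-(1 / 4) + -(3 / 4) : ℝ)) :=
      isBigO_bdd_mul_rpow hns (isBigO_mul_rpow hψ1 hψ2)
    have h3 := isBigO_bdd_mul_rpow hc hψ3
    have h12 := isBigO_add_rpow (e := -(3 / 4)) (by norm_num) (by norm_num) h1 (h2.const_mul_left 3)
    have h := isBigO_add_rpow (e := -(3 / 4)) le_rfl (by norm_num) h12 h3
    exact h.congr_left fun t ↦ by ring
  refine ⟨?_, ?_, ?_, ?_⟩
  · have h := (isBigO_mul_rpow hA0 S0).const_mul_left ε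
    exact (h.congr_left fun t ↦ by ring).trans (isBigO_rpow_of_le (by norm_num))
  · have h1 := isBigO_mul_rpow hA1 S0
    have h2 := isBigO_mul_rpow hA0 S1
    have h := (isBigO_add_rpow (e := -(3 / 8)) (by norm_num) (by norm_num) h1 h2).const_mul_left ε
    exact h.congr_left fun t ↦ by ring
  · have h1 := isBigO_mul_rpow hA2 S0
    have h2 := (isBigO_mul_rpow hA1 S1).const_mul_left 2
    have h3 := isBigO_mul_rpow hA0 S2
    have h12 := isBigO_add_rpow (e := -(5 / 8)) (by norm_num) (by norm_num) h1 h2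
    have h := (isBigO_add_rpow (e := -(5 / 8)) le_rfl (by norm_num) h12 h3).const_mul_left ε
    exact h.congr_left fun t ↦ by ring
  · have h1 := isBigO_mul_rpow hA3 S0
    have h2 := (isBigO_mul_rpow hA2 S1).const_mul_left 3
    have h3 := (isBigO_mul_rpow hA1 S2).const_mul_left 3
    have h4 := isBigO_mul_rpow hA0 S3
    have h12 := isBigO_add_rpow (e := -(7 / 8)) (by norm_num) (by norm_num) h1 h2
    have h123 := isBigO_add_rpow (e := -(7 / 8)) le_rfl (by norm_num) h12 h3
    have h := (isBigO_add_rpow (e := -(7 / 8)) le_rfl (by norm_num) h123 h4).const_mul_left ε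
    exact h.congr_left fun t ↦ by ring

/-- The concrete amplitude `(1+t²)^{-1/8}` and phase `(1+t²)^{1/4}` chains have the orders assumed in
`isBigO_witness2` (exponent bookkeeping on `isBigO_ampl`). [folklore] -/
theorem isBigO_witness2_concrete :
    (fun t : ℝ ↦ (1 + t ^ 2) ^ (-(1 / 8) : ℝ)) =O[atTop] (fun t : ℝ ↦ (1 + t ^ 2) ^ (-(1 / 8) : ℝ)) ∧
    (fun t : ℝ ↦ 2 * t * (-(1 / 8) : ℝ) * (1 + t ^ 2) ^ ((-(1 / 8) : ℝ) - 1))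
      =O[atTop] (fun t : ℝ ↦ (1 + t ^ 2) ^ (-(5 / 8) : ℝ)) ∧
    (fun t : ℝ ↦ 2 * (-(1 / 8) : ℝ) * (1 + t ^ 2) ^ ((-(1 / 8) : ℝ) - 1) +
        4 * (-(1 / 8) : ℝ) * ((-(1 / 8) : ℝ) - 1) * t ^ 2 * (1 + t ^ 2) ^ ((-(1 / 8) : ℝ) - 2))
      =O[atTop] (fun t : ℝ ↦ (1 + t ^ 2) ^ (-(9 / 8) : ℝ)) ∧
    (fun t : ℝ ↦ 12 * (-(1 / 8) : ℝ) * ((-(1 / 8) : ℝ) - 1) * t * (1 + t ^ 2) ^ ((-(1 / 8) : ℝ) - 2) +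
        8 * (-(1 / 8) : ℝ) * ((-(1 / 8) : ℝ) - 1) * ((-(1 / 8) : ℝ) - 2) * t ^ 3 *
          (1 + t ^ 2) ^ ((-(1 / 8) : ℝ) - 3))
      =O[atTop] (fun t : ℝ ↦ (1 + t ^ 2) ^ (-(13 / 8) : ℝ)) ∧
    (fun t : ℝ ↦ 2 * t * (1 / 4 : ℝ) * (1 + t ^ 2) ^ ((1 / 4 : ℝ) - 1))
      =O[atTop] (fun t : ℝ ↦ (1 + t ^ 2) ^ (-(1 / 4) : ℝ)) ∧
    (fun t : ℝ ↦ 2 * (1 / 4 : ℝ) * (1 + t ^ 2) ^ ((1 / 4 : ℝ) - 1) +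
        4 * (1 / 4 : ℝ) * ((1 / 4 : ℝ) - 1) * t ^ 2 * (1 + t ^ 2) ^ ((1 / 4 : ℝ) - 2))
      =O[atTop] (fun t : ℝ ↦ (1 + t ^ 2) ^ (-(3 / 4) : ℝ)) ∧
    (fun t : ℝ ↦ 12 * (1 / 4 : ℝ) * ((1 / 4 : ℝ) - 1) * t * (1 + t ^ 2) ^ ((1 / 4 : ℝ) - 2) +
        8 * (1 / 4 : ℝ) * ((1 / 4 : ℝ) - 1) * ((1 / 4 : ℝ) - 2) * t ^ 3 *
          (1 + t ^ 2) ^ ((1 / 4 : ℝ) - 3))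
      =O[atTop] (fun t : ℝ ↦ (1 + t ^ 2) ^ (-(5 / 4) : ℝ)) := by
  obtain ⟨a0, a1, a2, a3⟩ := isBigO_ampl (-(1 / 8) : ℝ)
  obtain ⟨-, q1, q2, q3⟩ := isBigO_ampl (1 / 4 : ℝ)
  refine ⟨a0, a1.congr_right fun t ↦ by norm_num, a2.congr_right fun t ↦ by norm_num,
    a3.congr_right fun t ↦ by norm_num, q1.congr_right fun t ↦ by norm_num,
    q2.congr_right fun t ↦ by norm_num, q3.congr_right fun t ↦ by norm_num⟩

end Summit.FinalStateConjecture.FinalStateConjecture.Theorems.WeightedQuasiStationarity.Negative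

end
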